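import Mathlib
import HarnessLib
import HarnessLib.Audit
import Summits.CriticalPhenomena.Statement
import Literature.Probability.RandomPlanarGeometry.ChordalCurveFamily
import Summits.CriticalPhenomena.SAWScalingLimit.Theorems.SAWZoomRigidityLSWRestrictionFact
import Summits.CriticalPhenomena.SAWScalingLimit.Theorems.SAWPoissonBanksLSWSimpleRestrictionIsSLE
import HarnessLib.Audit.Status.Attr

/-!
Route: SAWLoopAvoidanceChaos

DORMANT since 2026-08-22T04:37:56Z (reconciler: no traction for 5.1 d (last activity item-evidence-added at 2026-08-17T02:25:31Z); parked, not closed — `ledger route dormant route-CriticalPhenomena-SAWLoopAvoidanceChaos --off` to reacti) — unstaffed, not closed; items shared with open routes are served there. `ledger route dormant <id> --off` reactivates.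

# Route SAWLoopAvoidanceChaos — SLE(8/3) as renormalised loop-avoidance chaos of SLE(2); the
critical Z^2 SAW is its lattice shadow

It suffices to show X_LAC = (E) ∧ (U) ∧ (R) ∧ (L) [route realising idea card
loop-avoidance-chaos-sle2]. Fix the REGULARISED LOOP-AVOIDANCE SCHEME: for a Dobrushin domain D, a
cutoff ε > 0 and a counterterm θ : ℝ → ℝ, reweight the chordal SLE₂ law μ₂^D by dens_ε(γ) =
exp(θ(ε)·N_ε(γ) − m^RW_(D,ε)(hit_ε γ)), where hit_ε γ is the set of sites of the discrete domain Ω_ε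
= meshDomain Ω ε whose closed ε-box meets range γ, N_ε = #hit_ε γ, and m^RW is the random-walk loop
measure (rooted weight (1/4)^n/n, Lawler–Trujillo Ferreras / Kennedy–Lawler §1.1) of the loops of
Ω_ε visiting that set — so exp(−m^RW) is exactly the probability that an independent unit-intensity
random-walk loop soup on Ω_ε misses the boxes of γ; normalise to reg_ε^D ("SLE₂ conditioned to dodge
the mesh-ε loop soup, UV-renormalised by a box-count counterterm").
 (E) ChaosExists: for some θ the scheme converges weakly as ε → 0+, in every Dobrushin domain, to a
chordal family Q carried by simple curves meeting ∂D only at a, b.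
 (U) ChaosConformal: every such full limit family is conformally covariant (cutoff universality).
 (R) ChaosRestriction: every such limit family has the two-sided restriction property (the soup-void
ratio cancels the c = −2 restriction defect of SLE₂ scale by scale).
 (L) LatticeIsChaos: for every counterterm θ whose limit Q is chordal, simple, conformally covariant
and restriction, the critical δℤ² SAW law in (Ω_δ; a_δ, b_δ) is asymptotically equal to reg_ε^D: for
every bounded continuous f and η > 0 there is ε₀ with |∫ f∘curve dP^SAW_δ − ∫ f d reg_ε^D| < η for
all ε < ε₀ and all small δ. Mechanism: the EXACT identity x^(|η|) ∝ [LERW_δ weight 4^(−|η|)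
e^(m_δ(η))]·[soup-void e^(−m_δ(η))]·(4x)^(|η|) (Kozdron–Lawler λ-SAW at c = 0; Kennedy–Lawler §1.1),
LERW_δ → SLE₂, RW soup → Brownian soup.
Then LSW03 (shared support LSWRestrictionFact) identifies Q D as the chordal SLE_(8/3) law, and (L)
+ (E) give ConvergesInLawToSLE (8/3), i.e. SAWScalingLimit (Assembly, proved sorry-free in the
planner's Sketch.lean).
Lean: `ChaosExists ∧ ChaosConformal ∧ ChaosRestriction ∧ LatticeIsChaos` (X_LAC is literally the
conjunction of the four crux decls of this route file, namespace
Summit.CriticalPhenomena.SAWScalingLimit.Theses.SAWLoopAvoidanceChaos; each conjunct is the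
stand-alone one-line Prop given in its block below and elaborates with import
Literature.Probability.RandomPlanarGeometry.ChordalCurveFamily — checked in the planner's
Sketch.lean together with a sorry-free proof of Assembly)

## Assembly
Take the SLE₂ family sle2 D := preWienerMeasure.map Γ_D from exists_isSLECurve (κ = 2 > 0);
ChaosExists gives θ, Q (chordal, simple, convergent in every D); ChaosConformal and ChaosRestriction
upgrade Q; LSWRestrictionFact gives IsSLELaw (8/3) D (Q D) = law of an SLE_(8/3) curve Γ;
LatticeIsChaos (applied with the convergence in D) and the convergence reg_ε^D → Q D combine by a
two-scale ε/δ argument into TendstoLaw curve SAW.law Γ preWienerMeasure (integral_map);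
measurability is SAW.aemeasurable_curve. Pure bookkeeping: `theorem assembly_holds : Assembly` is
checked sorry-free (axioms propext, Classical.choice, Quot.sound) in the planner's Sketch.lean.

Rationale: WHY THIS LINE. Lawler–Werner (LawlerWerner2004; Lawler2008 Prop 5.34 and §9.3) run the ADDITIVE
direction: chordal SLE_κ plus the loops of an independent Brownian loop soup of parameter λ =
(8−3κ)α that it touches is the restriction measure P_α, and for κ = 2 (c = −2, α = b = 1, λ = 2 =
unit intensity μ^loop) "putting the erased bubbles back" gives the Brownian excursion; on the
lattice the same bookkeeping is an IDENTITY — the λ-SAW weight β^(|ω|) exp(−(c/2) m_D(ω)) with the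
random-walk loop measure interpolates LERW (c = −2) and SAW (c = 0) (KozdronLawler2007;
KennedyLawler2013 §1.1; Lawler2018 Prop 3.1), so the critical SAW law equals loop-erased walk
conditioned on an independent unit random-walk loop soup missing it, tilted by (4/μ)^(|η|). This
route runs the sentence BACKWARDS in the continuum with an ultraviolet renormalisation modelled on
Gaussian multiplicative chaos (Berestycki arXiv:1506.09113; loop-soup chaos AidekonEtAl2023):
SLE_(8/3) should be SLE₂ conditioned to dodge the soup above scale ε, with a diverging box-count
counterterm, and the identification is free because the soup-void ratio between D' ⊂ D cancels
SLE₂'s restriction defect exp(−m_D(γ, D∖D')) (Lawler2009 boundary-perturbation rule) at every cutoff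
on curves ε-away from D∖D', so LawlerSchrammWerner2003Restriction applies to any non-degenerate
limit. Imported areas: Brownian/random-walk loop measures and soups (LawlerWerner2004,
LawlerTrujilloferreras2006), conformal restriction (LSW03), multiplicative-chaos renormalisation
technology (second moments along the curve, cutoff universality). What it does that prior routes and
the negatives index do not: no observable, no vertex relation, no symmetry upgrade from lattice
symmetries, no tightness-at-all-δ statement (stmt-CriticalPhenomena-0772 is avoided: convergence is
asserted through an explicit regularised continuum object, never through IsTightLaws); the conformal
structure enters through SLE₂ and the loop soup, both theorems, and the SAW-specific difficulty is
isolated in ONE comparison (L) with an explicit, samplable object at each ε.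

RANKED CRUXES. #2 ChaosExists (crux) — (card Q1) Given the chordal SLE₂ laws (any family sle2 with
IsSLELaw 2 D (sle2 D)), there are a counterterm θ : ℝ → ℝ and a chordal family Q, carried in every
Dobrushin domain by simple curves meeting ∂D only at the marked points, such that for every D the
regularised loop-avoidance laws reg_ε^D = normalise(exp(θ(ε)·#hit_ε γ − m^RW_(D,ε)(hit_ε γ)) · sle2
D) converge weakly (TendstoLaw with the identity variable) to Q D as ε → 0+. Existence,
non-degeneracy and ONE-counterterm sufficiency of the loop-avoidance chaos; the same θ for all
domains (the counterterm is an interior, local quantity; boundary-layer effects at a, b are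
germ-trivial). [difficulty: open-problem] (why it might fail: One scalar counterterm may not suffice
(turn/box-geometry energies at intermediate order), or no θ(ε) gives a non-degenerate SIMPLE limit
in all domains at once; chaos for Poisson-void functionals along fractal curves has no theory yet —
GMC is an analogy, not a theorem.) [LawlerWerner2004, Lawler2008,
LawlerSchrammWerner2003Restriction, AidekonEtAl2023, arXiv:1506.09113, KennedyLawler2013,
Lawler2009]
#3 LatticeIsChaos (crux) — (card Q3, conditional form) For every SLE₂ family, every counterterm θ
and every chordal family Q that is carried by simple boundary-avoiding curves, conformally covariant
and restriction (hence SLE_(8/3) by LSW03), and every Dobrushin domain with an endpoint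
approximation (SAW.IsEndpointApprox) in which reg_ε^D → Q D: for every bounded continuous f on
CurveClass ℂ and η > 0 there is ε₀ > 0 such that for all ε ∈ (0, ε₀), eventually as δ → 0+, |∫
f∘curve dSAW.law_δ − ∫ f d reg_ε^D| < η. Informal mechanism (the two-layer plan): SAW.law_δ = LERW_δ
⊗ 1{unit RW soup on Ω_δ misses η} ⊗ (4x_c)^(|η|) EXACTLY; replace the sub-ε loops and the length
fugacity by the box-count counterterm (mesoscopic reduction = local universality), then LERW_δ →
SLE₂ (LSW04) and RW soup_δ → RW soup_ε → Brownian soup (Lawler–Trujillo Ferreras) at fixed ε. [deps: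
ChaosExists] [difficulty: open-problem] (why it might fail: Hides SAW tightness and a
local-universality step ('sub-ε loops + length fugacity ≈ box-count tilt'): local pattern energies
(turns, contacts) may need a richer counterterm, and LERW with local tilts has no harmonic-explorer
structure; boundary lattice effects (Kennedy–Lawler).) [KozdronLawler2007, KennedyLawler2013,
Lawler2018, LawlerLimic2010, LawlerTrujilloferreras2006, LawlerSchrammWerner2004,
LawlerSchrammWerner2004SAW]
#4 ChaosConformal (crux) — (card Q1/Q2, universality half) For every SLE₂ family, θ and chordal Q
carried by simple boundary-avoiding curves: if reg_ε^D → Q D weakly in EVERY Dobrushin domain, then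
Q is conformally covariant (ChordalFamily.IsConformallyCovariant). Mechanism: SLE₂ and the loop soup
are conformally invariant; under a conformal map the scheme becomes the same scheme with a locally
rescaled cutoff and the image random-walk soup (still converging to the Brownian soup), and the
counterterm θ(ε)N_ε is asymptotically local, so cutoff universality (as for GMC) transports the
limit. [deps: ChaosExists] [difficulty: XL] (why it might fail: The regulariser (εℤ² soup,
axis-parallel boxes) is Euclidean: a limit could remember it (D4-only covariance) if counterterm
universality fails along the curve (fluctuations of N_ε between cutoffs diverge); no
symmetry-upgrade theorem can substitute.) [Lawler2008, LawlerTrujilloferreras2006, arXiv:1506.09113,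
AidekonEtAl2023, Literature.Barriers.CriticalPhenomena.ScaleCovarianceNotMoebius,
Literature.Barriers.CriticalPhenomena.EmbeddingModulusUniqueness, Beffara2008Universal]
#5 ChaosRestriction (crux) — (card Q2) Same hypotheses as ChaosConformal; conclusion: Q has the
two-sided restriction property (ChordalFamily.IsRestriction). Mechanism: for D' ⊆ D with the same
marked points and γ ⊂ D' at distance ≥ 2ε from A = D∖D', dens^(D')_ε(γ)/dens^D_ε(γ) =
exp(+m^RW_(D,ε)(loops hitting the boxes of γ and leaving Ω'_ε)), while dμ₂^(D')/dμ₂^D ∝ 1{γ⊂D'}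
exp(−m^BL_D(γ, A)) (c = −2 boundary-perturbation rule); random-walk loop measure → Brownian loop
measure for these macroscopic loops, so reg^(D')_ε ∝ (1+o(1))·reg^D_ε on {dist(γ, A) ≥ η}, and
portmanteau + boundary avoidance of Q pass the identity to the limit. [deps: ChaosExists]
[difficulty: L] (why it might fail: RW-loop vs Brownian-loop masses must agree uniformly along rough
random curves; IsRestriction is typed for ALL D' ⊆ D sharing a, b (no agree-near-a,b proviso, cf.
notes on stmt-CriticalPhenomena-0773) where the cancellation is empty and only continuity in D' can
help.) [LawlerTrujilloferreras2006, Lawler2009, LawlerSchrammWerner2003Restriction, Lawler2008,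
LawlerWerner2004]
#9 LatticeIsChaosSome (support) — Unconditional companion of LatticeIsChaos (numerics target and
refutation guard): for SOME counterterm θ, in every Dobrushin domain and endpoint approximation, for
every bounded continuous f and η > 0 there is ε₀ > 0 with |∫ f∘curve dSAW.law_δ − ∫ f d reg_ε^D| < η
for all ε ∈ (0, ε₀), eventually in δ. It forces uniqueness of subsequential SAW limits (they all
equal lim_ε reg_ε^D) and is what the kit experiment tests at accessible ε; its negation retires the
card. [difficulty: open-problem] [KennedyLawler2013, KozdronLawler2007, LawlerSchrammWerner2004SAW]
#9 LoopErasureIdentity (support) — The exact lattice anchor, typed with Mathlib's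
`SimpleGraph.Walk.bypass` (= reverse-chronological loop erasure; the identity is insensitive to the
erasure order because F_η = exp m(loops meeting the SET η) and 4^(−|ω|) is reversal-symmetric): for
bounded Ω, δ > 0 and every SAW η of Ω_δ from a to b, Σ_(ω : walks a → b of Ω_δ with bypass ω = η)
4^(−|ω|) = 4^(−|η|) · exp(m^RW(loops of Ω_δ meeting η)) (Lawler–Limic Prop 9.5.1 with Lemma 9.3.2;
Lawler2018 Prop 3.1; reversal: Lawler 1991 Lemma 7.2.1). Dividing by G_(Ω_δ)(a,b) = Σ_ω 4^(−|ω|)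
this says LERW_δ(η) = 4^(−|η|) F_η / G, and with x_c^(|η|) = (4x_c)^(|η|)·4^(−|η|): SAW.weight{η} ∝
LERW_δ(η) · P[unit RW loop soup on Ω_δ misses η] · (4x_c)^(|η|) — the c = 0 ↔ c = −2 dictionary the
whole route rests on. Provable now in principle (finite combinatorics of loop insertion), sizeable
as a formalisation. [difficulty: L] [LawlerLimic2010, Lawler2018, KozdronLawler2007,
KennedyLawler2013, LawlerTrujilloferreras2006]
#9 LSWRestrictionFact (support) — Shared with routes SAWConfRestriction / SAWRestrictionRigidity
(stmt-CriticalPhenomena-0775, same signature): Lawler–Schramm–Werner 2003 transposed to chordal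
families on Dobrushin domains — given exists_isSLECurve and IsSLECurve.map_eq, a chordal family that
is conformally covariant, restriction and carried by simple boundary-avoiding curves is in every
domain the chordal SLE_(8/3) law. Expected to close by citation. [difficulty: provable-now]
[LawlerSchrammWerner2003Restriction, Lawler2008]

TWO-LAYER PLAN. Foreseen glued splits (nothing filed now; k ≤ 3 each):
- ChaosExists ⇐ E1 (tightness and non-triviality of (reg_ε^D)_ε for a box-count-calibrated θ:
second-moment / thick-point estimates for the centred void functional along SLE₂, using the
independence of the Poisson soup and SLE₂'s domain Markov property) → E2 (uniqueness of
subsequential limits from the exact mesoscopic restriction identity + 'avoidance probabilities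
determine a simple chordal law', cf. SAWRestrictionRigidity.AvoidanceDeterminesLaw) → ChaosExists.
- LatticeIsChaos ⇐ L1 (mesoscopic reduction ON THE LATTICE: SAW.law_δ ≈ LERW_δ ⊗ void of the mesh-ε
soup on the ε-boxes ⊗ e^(θN_ε), δ → 0 then ε → 0 — needs defn RandomWalkLoopMeasure/LERW law) → L2
(fixed-cutoff convergence: LERW_δ ⊗ void_ε ⊗ tilt → SLE₂ ⊗ void_ε ⊗ tilt as δ → 0 for each ε, θ:
chordal LERW → SLE₂ plus a.e. continuity of the explicit bounded density) → LatticeIsChaos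
(counterterm matching via criticality of both sides).
- ChaosConformal ⇐ U1 (dilation covariance along ε ↦ λε with θ re-tuned) → U2 (rotation covariance:
rotated boxes/soup give the same limit) → ChaosConformal (local cutoff deformation under a conformal
map; Beltrami-free because SLE₂ and the soup are already conformally invariant).

KILL CRITERIA. ¬ChaosExists in the strong form 'for every θ the scheme degenerates (non-simple or
Dirac/geodesic limits) in some domain' closes the route refuted:ChaosExists unless the refutation
exhibits the missing second counterterm (then restate dens with it: one repair, not a new route). An
explicit anisotropic (D4-only) limit family refutes ChaosConformal and closes the route — recorded
as a new barrier 'loop-avoidance chaos remembers the cutoff'. ¬ChaosRestriction can only come from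
the all-D' corner of IsRestriction (restate with the agree-near-a,b proviso, sharing the fate of
stmt-CriticalPhenomena-0773). ¬LatticeIsChaos with E, U, R standing means the critical SAW is not in
the loop-avoidance class: closes the route and the card. Numerics contradicting LatticeIsChaosSome
at accessible ε → dormant. If SAWRestrictionRigidity's LimitExists + AxiomsOfLimit + Rigidity all
close, L loses urgency (the conjunct is then proved) but E/U keep stand-alone value as a theorem
about SLE.

NOT DECOMPOSED YET. The exact lattice identity IS filed (support LoopErasureIdentity, via Mathlib's
Walk.bypass), but the pure-lattice mesoscopic reduction (L1: SAW.law_δ ≈ LERW_δ ⊗ mesh-ε soup-void ⊗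
e^(θN_ε)) and the fixed-cutoff convergence (L2) are not items yet: they are the foreseen children of
LatticeIsChaos and read better once RandomWalkLoopMeasure / LERW.law exist as definitions
(requested). The Brownian-loop (exact-restriction-at-every-cutoff) version of the scheme is not
typed (needs defn BrownianLoopMeasure); the typed scheme uses the mesh-ε random-walk soup, for which
restriction is exact only up to the RW→Brownian loop comparison (inside ChaosRestriction).
Measurability of γ ↦ hit_ε γ, finiteness/positivity of the normalising constant, summability of the
loop series, and the portmanteau bookkeeping are layer-2 lemmas riding with --supports. No
quantitative rate (ε/ε')^ω is claimed anywhere.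

CHEAPEST FALSIFIER. (i) Conventions: in 6×6–8×8 boxes, exact enumeration must reproduce SAW.law from
LERW weights 4^(−n)·det-ratio times the soup-void det-ratio times (4x_c)^n (an identity — checks the
(1/4)^n/n normalisation and the domain-graph convention). (ii) The real test (kit, not run in this
planning session): sample fine-mesh LERW (δ ≪ ε) or discretised SLE₂ in the unit disc, an
independent random-walk loop soup at mesh ε, reweight by 1{soup misses the ε-boxes of γ}·e^(θN_ε)
with θ tuned so that ε^(4/3)N_ε stays O(1); as ε halves (ε = 1/16 … 1/128) the estimated restriction
exponent P[γ avoids a boundary slit A] ≈ Φ'_A^α and the box dimension must drift toward (α, d) =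
(5/8, 4/3) and two cutoff shapes (boxes vs discs) must agree; compare ∫ f d reg_ε with
pivot-algorithm SAW samples for a few crossing-type f. Exponentially growing weights make this an
importance-sampling problem — if even ε = 1/32 is out of reach, that itself lowers the route's
plausibility score but does not refute it.

NUMBERS. Lattice counterterm at ε = δ: θ = log(4x_c) = log(4/μ) ≈ 0.416 with μ(ℤ²) ≈ 2.63816
(LawlerSchrammWerner2004SAW §3.1: 2.6 ≤ μ ≤ 2.7). Central charge c(2) = −2, boundary exponent b = 1,
compensating soup parameter λ = (8−3κ)α = 2 in Lawler's convention = unit intensity μ^loop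
(Lawler2008 §9.3, (6.9)); restriction exponent of the target 5/8, κ = 8/3
(LawlerSchrammWerner2003Restriction); dimensions 5/4 (SLE₂, natural length) and 4/3 (SLE_(8/3)); N_ε
≍ ε^(−5/4) under SLE₂ and ≍ ε^(−4/3) under the critical reweighting.

DEFINITION REQUESTS. - BrownianLoopMeasure (topic Literature/Probability/RandomPlanarGeometry): the
σ-finite measure μ^loop_D on unrooted loops (Lawler2008 §5.6, LawlerWerner2004) with restriction and
conformal invariance, and the two-set mass Λ_D(K₁, K₂); needed for the exact-restriction version of
the scheme and for ChaosRestriction's comparison.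
- RandomWalkLoopMeasure and LERW.law on discreteDomainGraph (topic
Literature/Probability/LatticeModels): rooted weight (1/4)^n/n (LawlerTrujilloferreras2006;
LawlerLimic2010 Ch. 9), F_V(A) = exp m(loops hitting V) = det G_A / det G_(A∖V), and the chordal
loop-erased walk law P(η) = 4^(−|η|) F_η(Ω_δ)/G_(Ω_δ)(a, b); needed to file the exact identity and
the lattice mesoscopic reduction L1.
- LoopAvoidance.regularisedLaw (topic Summits/CriticalPhenomena/SAWScalingLimit/Theorems): the
scheme reg_ε^D(θ, μ) as a definition, so that the five signatures shrink to one line each.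

Novelty: Searches (2026-08-15): `lit search --hybrid "SLE conditioned to avoid Brownian loop soup restriction
measure SLE(8/3) from SLE(2)"` (12 local docs: Lawler2005 book pp.223–225, Werner math/0307353 — all
the ADDITIVE direction); `lit search --source crossref` ×4 ("Partition functions loop measure
versions of SLE" → doi:10.1007/s10955-009-9704-6; "random walk loop soup" →
doi:10.1090/s0002-9947-06-03916-x; "multiplicative chaos Brownian loop soup" →
doi:10.1112/plms.12511, Jego doi:10.1214/19-aop1399, doi:10.1007/s00220-022-04570-z; "λ-SAW Kozdron
Lawler" → doi:10.1090/fic/050/09, Hattori–Ogo–Otsuka doi:10.3934/dcdss.2017014); `lit galaxy search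
"conditioned to avoid the loop soup" --star all` (0 hits) and `"loop soup" --star all` (30 rows,
none on conditioning SLE₂); `lit frontier CriticalPhenomena --since 2020` (30 descendants, none on
loop-soup conditioning of SLE₂/LERW); `lit bridges CriticalPhenomena --cross any` (surveys only);
`lit read` Lawler2005 pp.10, 223–225 and KennedyLawler2013 pp.4–5; arXiv API rate-limited (429).
Plus the card's own reads (math/0304419 p.3, math/0209343 §§5–9, 1109.3091 §1.1, 1709.07531 Prop
3.1) and its refuter audit (grade new-combination).
Nearest prior art found: Lawler2008 §9.3 / Prop 5.34 and LawlerWerner2004 (SLE_κ + loop soup of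
parameter λ = P_α: the additive direction, κ = 2 gives the excursion); KozdronLawler2007 +
KennedyLawler2013 §1.1 + Lawler2018 Prop 3.1 (λ-SAW: the exact lattice weight β^n exp(−(c/2)m_D),
'small loops set β_c, la  [refs: 10.1007/s10955-009-9704-6, 10.1090/s0002-9947-06-03916-x, 10.1112/plms.12511, 10.1214/19-aop1399, 10.1007/s00220-022-04570-z, 10.1090/fic/050/09, 10.3934/dcdss.2017014, 1210.3264, doi:10.1007/s10955-009-9704-6, doi:10.1090/s0002-9947-06-03916-x, doi:10.1112/plms.12511, doi:10.1214/19-aop1399, doi:10.1007/s00220-022-04570-z, doi:10.1090/fic/050/09, doi:10.3934/dcdss.2017014, Lawler2005, KennedyLawl]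

Barriers (technique_class: loop-soup-conditioning, multiplicative-chaos): - technique_class: loop-soup-conditioning, multiplicative-chaos
- Literature.Barriers.CriticalPhenomena.SAWNotKineticallyGrown: evaded — no growth rule; LERW/SLE₂
enter only through their finished laws and the SAW is produced by conditioning on an independent
soup plus a tilt, not by local transition probabilities.
- Literature.Barriers.CriticalPhenomena.PlanarEdwardsModelDiffusive: evaded in letter (the reference
process is SLE₂, not Brownian motion, and the reweighting is a void-conditioning with a DIVERGING
counterterm, singular w.r.t. SLE₂ in the limit — outside the bounded-fluctuation-energy Gibbs-tilt
class); its moral is mirrored by the subcritical check: without renormalisation (θ below critical)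
the scheme collapses to Euclidean geodesics, exactly as x < x_c does.
- Literature.Barriers.CriticalPhenomena.SupercriticalSAWSpaceFilling: nothing is fugacity-robust —
θ(ε) must sit in the critical window (the continuum shadow of x = x_c); larger θ gives
non-simple/dense limits excluded by the simplicity clause, smaller θ Dirac geodesic families
excluded by boundary avoidance in pinched domains; pinning θ is part of ChaosExists, not assumed.
- Literature.Barriers.CriticalPhenomena.NienhuisWeightsExcludeVertexSAW: evaded — no observable and
no vertex relation on ℤ² is used anywhere.
- Literature.Barriers.CriticalPhenomena.ParafermionicHalfCauchyRiemann: evaded — same reason;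
conformal structure comes from SLE₂ and the loop soup, both theorems.
- Literature.Barriers.CriticalPh

Novelty grade: new-combination — ROUTE REVIEW gen-2 addendum (refuter …-32c464e2-g2-0, 2026-08-15 14:30Z; texts REVIEW_R1.md [gen-0] + REVIEW_G2.md [g2] on stmt-4527). Grade unchanged: new-combination (gen-0's documented reading of LW04 / Lawler08 §9.3 / Kozdron–Lawler / Kennedy–Lawler concurs with the card audit; lit searchd unava (refuter refuter-rreview-route-CriticalPhenomena--32c464e2-g2-0, 2026-08-15T14:31:17Z; prior: LawlerWerner2004, Lawler2008 §9.3 / Prop 5.34, KozdronLawler2007 (doi:10.1090/fic/050/09), KennedyLawler2013 §1.1 (arXiv:1109.3091), Lawler2018 Prop 3.1 (arXiv:1709.07531), Lawler2009 doi:10.1007/s10955-009-9704-6, LawlerTrujilloFerreras2004 doi:10.1090/s0002-9947-06-03916-x, arXiv:1210.3264 (Werner–Wu), AidekonEtAl2023 (loop-soup chaos), arXiv:1506.09113 (Berestycki GMC))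

History (route lifecycle, newest last):
- 2026-08-16T14:43:06Z · LINT AUTOFIX route.multi-assembly: kept Assembly, dropped Assembly2 (gate:hygiene)
- 2026-08-22T04:37:56Z · DORMANT — reconciler: no traction for 5.1 d (last activity item-evidence-added at 2026-08-17T02:25:31Z); parked, not closed — `ledger route dormant route-CriticalPhenomen (operator:999:3695513)

sub-problem: SAWScalingLimit · status: dormant · opened planner-plancard-CriticalPhenomena-SAWScaling-5b755337-0 2026-08-15T11:34:26Z · rev 2 · ledger route-CriticalPhenomena-SAWLoopAvoidanceChaos
GENERATED by the gate from the ledger (D-0016/17). Provers cite these decls: `theorem foo : Summit.CriticalPhenomena.SAWScalingLimit.Theses.SAWLoopAvoidanceChaos.<Decl> := …` in Summits/CriticalPhenomena/SAWScalingLimit/Theorems/<Name>.lean.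
-/

namespace Summit.CriticalPhenomena.SAWScalingLimit.Theses.SAWLoopAvoidanceChaos

open scoped BigOperators Topology Manifold Classical MeasureTheory ProbabilityTheory Matrix InnerProductSpace ComplexConjugate ContinuousMap
open Filter Set Function TopologicalSpace MeasureTheory

attribute [summit_statement] _root_.SAWScalingLimit

/-- item stmt-CriticalPhenomena-4521 · crux · rank 2 · open · by planner
why it might fail: One scalar counterterm may not suffice (turn/box-geometry energies at intermediate order), or no θ(ε) gives a non-degenerate SIMPLE limit in all domains at once; chaos for Poisson-void functionals along fractal curves has no theory yet — GMC is an analogy, not a theorem.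
sources: LawlerWerner2004, Lawler2008, LawlerSchrammWerner2003Restriction, AidekonEtAl2023, arXiv:1506.09113, KennedyLawler2013
[crux] (card Q1) Given the chordal SLE₂ laws (any family sle2 with IsSLELaw 2 D (sle2 D)), there are
a counterterm θ : ℝ → ℝ and a chordal family Q, carried in every Dobrushin domain by simple curves
meeting ∂D only at the marked points, such that for every D the regularised loop-avoidance laws
reg_ε^D = normalise(exp(θ(ε)·#hit_ε γ − m^RW_(D,ε)(hit_ε γ)) · sle2 D) converge weakly (TendstoLaw
with the identity variable) to Q D as ε → 0+. Existence, non-degeneracy and ONE-counterterm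
sufficiency of the loop-avoidance chaos; the same θ for all domains (the counterterm is an interior,
local quantity; boundary-layer effects at a, b are germ-trivial). [difficulty: open-problem] -/
@[route_item "route-CriticalPhenomena-SAWLoopAvoidanceChaos", crux]
def ChaosExists : Prop :=
  ∀ sle2 : Literature.Probability.RandomPlanarGeometry.ChordalFamily, (∀ D : Literature.Probability.RandomPlanarGeometry.DobrushinDomain, Literature.Probability.RandomPlanarGeometry.IsSLELaw 2 D (sle2 D)) → ∃ (θ : ℝ → ℝ) (Q : Literature.Probability.RandomPlanarGeometry.ChordalFamily), Q.IsChordal ∧ (∀ D : Literature.Probability.RandomPlanarGeometry.DobrushinDomain, ∀ᵐ γ ∂(Q D), γ ∈ Literature.Probability.RandomPlanarGeometry.CurveClass.simple ∧ γ.range ∩ frontier D.carrier ⊆ {D.pt 0, D.pt 1}) ∧ ∀ D : Literature.Probability.RandomPlanarGeometry.DobrushinDomain, let box : ℝ → Literature.Probability.LatticeModels.Site 2 → Set ℂ := fun ε x => {z : ℂ | |z.re - ε * ((x 0 : ℤ) : ℝ)| ≤ ε / 2 ∧ |z.im - ε * ((x 1 : ℤ) : ℝ)| ≤ ε / 2};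 let hit : ℝ → Literature.Probability.RandomPlanarGeometry.CurveClass ℂ → Set (Literature.Probability.LatticeModels.Site 2) := fun ε γ => {x | x ∈ Literature.Probability.LatticeModels.meshDomain D.carrier ε ∧ (box ε x ∩ γ.range).Nonempty}; let mass : ℝ → Set (Literature.Probability.LatticeModels.Site 2) → ℝ := fun ε W => ∑' p : (Σ x : Literature.Probability.LatticeModels.Site 2, (Literature.Probability.LatticeModels.discreteDomainGraph D.carrier ε).Walk x x), (if 0 < p.2.length ∧ (∃ v ∈ p.2.support, v ∈ W) then ((1 : ℝ) / 4) ^ p.2.length / (p.2.length : ℝ) else 0); let dens : ℝ → Literature.Probability.RandomPlanarGeometry.CurveClass ℂ → ℝ := fun ε γ => Real.exp (θ ε * ((hit ε γ).ncard : ℝ) - mass ε (hit ε γ)); let reg : ℝ → MeasureTheory.Measure (Literature.Probability.RandomPlanarGeometry.CurveClass ℂ) := fun ε => (∫⁻ γ, ENNReal.ofReal (dens ε γ) ∂(sle2 D))⁻¹ • (sle2 D).withDensity (fun γ => ENNReal.ofReal (dens ε γ)); Literature.Probability.RandomPlanarGeometry.TendstoLaw (fun (_ : ℝ) (x : Literature.Probability.RandomPlanarGeometry.CurveClass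 ℂ) => x) reg id (Q D)

/-- item stmt-CriticalPhenomena-4522 · crux · rank 3 · open · by planner
why it might fail: Hides SAW tightness and a local-universality step ('sub-ε loops + length fugacity ≈ box-count tilt'): local pattern energies (turns, contacts) may need a richer counterterm, and LERW with local tilts has no harmonic-explorer structure; boundary lattice effects (Kennedy–Lawler).
sources: KozdronLawler2007, KennedyLawler2013, Lawler2018, LawlerLimic2010, LawlerTrujilloferreras2006, LawlerSchrammWerner2004
[crux] (card Q3, conditional form) For every SLE₂ family, every counterterm θ and every chordal
family Q that is carried by simple boundary-avoiding curves, conformally covariant and restriction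
(hence SLE_(8/3) by LSW03), and every Dobrushin domain with an endpoint approximation
(SAW.IsEndpointApprox) in which reg_ε^D → Q D: for every bounded continuous f on CurveClass ℂ and η
> 0 there is ε₀ > 0 such that for all ε ∈ (0, ε₀), eventually as δ → 0+, |∫ f∘curve dSAW.law_δ − ∫ f
d reg_ε^D| < η. Informal mechanism (the two-layer plan): SAW.law_δ = LERW_δ ⊗ 1{unit RW soup on Ω_δ
misses η} ⊗ (4x_c)^(|η|) EXACTLY; replace the sub-ε loops and the length fugacity by the box-count
counterterm (mesoscopic reduction = local universality), then LERW_δ → SLE₂ (LSW04) and RW soup_δ →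
RW soup_ε → Brownian soup (Lawler–Trujillo Ferreras) at fixed ε. [deps: ChaosExists] [difficulty:
open-problem] -/
@[route_item "route-CriticalPhenomena-SAWLoopAvoidanceChaos", crux]
def LatticeIsChaos : Prop :=
  ∀ sle2 : Literature.Probability.RandomPlanarGeometry.ChordalFamily, (∀ D : Literature.Probability.RandomPlanarGeometry.DobrushinDomain, Literature.Probability.RandomPlanarGeometry.IsSLELaw 2 D (sle2 D)) → ∀ (θ : ℝ → ℝ) (Q : Literature.Probability.RandomPlanarGeometry.ChordalFamily), Q.IsChordal → (∀ D : Literature.Probability.RandomPlanarGeometry.DobrushinDomain, ∀ᵐ γ ∂(Q D), γ ∈ Literature.Probability.RandomPlanarGeometry.CurveClass.simple ∧ γ.range ∩ frontier D.carrier ⊆ {D.pt 0, D.pt 1}) → Q.IsConformallyCovariant → Q.IsRestriction → ∀ (D : Literature.Probability.RandomPlanarGeometry.DobrushinDomain) (a b : ℝ → Literature.Probability.LatticeModels.Site 2), Literature.Probability.RandomPlanarGeometry.SAW.IsEndpointApprox D a b → let box : ℝ → Literature.Probability.LatticeModels.Site 2 → Set ℂ := fun ε x => {z : ℂ | |z.re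 - ε * ((x 0 : ℤ) : ℝ)| ≤ ε / 2 ∧ |z.im - ε * ((x 1 : ℤ) : ℝ)| ≤ ε / 2}; let hit : ℝ → Literature.Probability.RandomPlanarGeometry.CurveClass ℂ → Set (Literature.Probability.LatticeModels.Site 2) := fun ε γ => {x | x ∈ Literature.Probability.LatticeModels.meshDomain D.carrier ε ∧ (box ε x ∩ γ.range).Nonempty}; let mass : ℝ → Set (Literature.Probability.LatticeModels.Site 2) → ℝ := fun ε W => ∑' p : (Σ x : Literature.Probability.LatticeModels.Site 2, (Literature.Probability.LatticeModels.discreteDomainGraph D.carrier ε).Walk x x), (if 0 < p.2.length ∧ (∃ v ∈ p.2.support, v ∈ W) then ((1 : ℝ) / 4) ^ p.2.length / (p.2.length : ℝ) else 0); let dens : ℝ → Literature.Probability.RandomPlanarGeometry.CurveClass ℂ → ℝ := fun ε γ => Real.exp (θ ε * ((hit ε γ).ncard : ℝ) - mass ε (hit ε γ)); let reg : ℝ → MeasureTheory.Measure (Literature.Probability.RandomPlanarGeometry.CurveClass ℂ) := fun ε => (∫⁻ γ, ENNReal.ofReal (dens ε γ) ∂(sle2 D))⁻¹ • (sle2 D).withDensity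 (fun γ => ENNReal.ofReal (dens ε γ)); (Literature.Probability.RandomPlanarGeometry.TendstoLaw (fun (_ : ℝ) (x : Literature.Probability.RandomPlanarGeometry.CurveClass ℂ) => x) reg id (Q D)) → ∀ (f : BoundedContinuousFunction (Literature.Probability.RandomPlanarGeometry.CurveClass ℂ) ℝ) (η : ℝ), 0 < η → ∃ ε₀ : ℝ, 0 < ε₀ ∧ ∀ ε ∈ Set.Ioo (0 : ℝ) ε₀, ∀ᶠ δ in nhdsWithin (0 : ℝ) (Set.Ioi 0), |(∫ γ, f γ.curve ∂(Literature.Probability.RandomPlanarGeometry.SAW.law D.carrier δ (a δ) (b δ))) - ∫ x, f x ∂(reg ε)| < η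

/-- item stmt-CriticalPhenomena-4523 · crux · rank 4 · open · by planner
why it might fail: The regulariser (εℤ² soup, axis-parallel boxes) is Euclidean: a limit could remember it (D4-only covariance) if counterterm universality fails along the curve (fluctuations of N_ε between cutoffs diverge); no symmetry-upgrade theorem can substitute.
sources: Lawler2008, LawlerTrujilloferreras2006, arXiv:1506.09113, AidekonEtAl2023, Literature.Barriers.CriticalPhenomena.ScaleCovarianceNotMoebius, Literature.Barriers.CriticalPhenomena.EmbeddingModulusUniqueness
[crux] (card Q1/Q2, universality half) For every SLE₂ family, θ and chordal Q carried by simple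
boundary-avoiding curves: if reg_ε^D → Q D weakly in EVERY Dobrushin domain, then Q is conformally
covariant (ChordalFamily.IsConformallyCovariant). Mechanism: SLE₂ and the loop soup are conformally
invariant; under a conformal map the scheme becomes the same scheme with a locally rescaled cutoff
and the image random-walk soup (still converging to the Brownian soup), and the counterterm θ(ε)N_ε
is asymptotically local, so cutoff universality (as for GMC) transports the limit. [deps:
ChaosExists] [difficulty: XL] -/
@[route_item "route-CriticalPhenomena-SAWLoopAvoidanceChaos", crux]
def ChaosConformal : Prop :=
  ∀ sle2 : Literature.Probability.RandomPlanarGeometry.ChordalFamily, (∀ D : Literature.Probability.RandomPlanarGeometry.DobrushinDomain, Literature.Probability.RandomPlanarGeometry.IsSLELaw 2 D (sle2 D)) → ∀ (θ : ℝ → ℝ) (Q : Literature.Probability.RandomPlanarGeometry.ChordalFamily), Q.IsChordal → (∀ D : Literature.Probability.RandomPlanarGeometry.DobrushinDomain, ∀ᵐ γ ∂(Q D), γ ∈ Literature.Probability.RandomPlanarGeometry.CurveClass.simple ∧ γ.range ∩ frontier D.carrier ⊆ {D.pt 0, D.pt 1}) → (∀ D : Literature.Probability.RandomPlanarGeometry.DobrushinDomain,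 let box : ℝ → Literature.Probability.LatticeModels.Site 2 → Set ℂ := fun ε x => {z : ℂ | |z.re - ε * ((x 0 : ℤ) : ℝ)| ≤ ε / 2 ∧ |z.im - ε * ((x 1 : ℤ) : ℝ)| ≤ ε / 2}; let hit : ℝ → Literature.Probability.RandomPlanarGeometry.CurveClass ℂ → Set (Literature.Probability.LatticeModels.Site 2) := fun ε γ => {x | x ∈ Literature.Probability.LatticeModels.meshDomain D.carrier ε ∧ (box ε x ∩ γ.range).Nonempty}; let mass : ℝ → Set (Literature.Probability.LatticeModels.Site 2) → ℝ := fun ε W => ∑' p : (Σ x : Literature.Probability.LatticeModels.Site 2, (Literature.Probability.LatticeModels.discreteDomainGraph D.carrier ε).Walk x x), (if 0 < p.2.length ∧ (∃ v ∈ p.2.support, v ∈ W) then ((1 : ℝ) / 4) ^ p.2.length / (p.2.length : ℝ) else 0); let dens : ℝ → Literature.Probability.RandomPlanarGeometry.CurveClass ℂ → ℝ := fun ε γ => Real.exp (θ ε * ((hit ε γ).ncard : ℝ) - mass ε (hit ε γ)); let reg : ℝ → MeasureTheory.Measure (Literature.Probability.RandomPlanarGeometry.CurveClass ℂ) := fun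 ε => (∫⁻ γ, ENNReal.ofReal (dens ε γ) ∂(sle2 D))⁻¹ • (sle2 D).withDensity (fun γ => ENNReal.ofReal (dens ε γ)); Literature.Probability.RandomPlanarGeometry.TendstoLaw (fun (_ : ℝ) (x : Literature.Probability.RandomPlanarGeometry.CurveClass ℂ) => x) reg id (Q D)) → Q.IsConformallyCovariant

/-- item stmt-CriticalPhenomena-4524 · crux · rank 5 · open · by planner
why it might fail: RW-loop vs Brownian-loop masses must agree uniformly along rough random curves; IsRestriction is typed for ALL D' ⊆ D sharing a, b (no agree-near-a,b proviso, cf. notes on stmt-CriticalPhenomena-0773) where the cancellation is empty and only continuity in D' can help.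
sources: LawlerTrujilloferreras2006, Lawler2009, LawlerSchrammWerner2003Restriction, Lawler2008, LawlerWerner2004
[crux] (card Q2) Same hypotheses as ChaosConformal; conclusion: Q has the two-sided restriction
property (ChordalFamily.IsRestriction). Mechanism: for D' ⊆ D with the same marked points and γ ⊂ D'
at distance ≥ 2ε from A = D∖D', dens^(D')_ε(γ)/dens^D_ε(γ) = exp(+m^RW_(D,ε)(loops hitting the boxes
of γ and leaving Ω'_ε)), while dμ₂^(D')/dμ₂^D ∝ 1{γ⊂D'} exp(−m^BL_D(γ, A)) (c = −2
boundary-perturbation rule); random-walk loop measure → Brownian loop measure for these macroscopic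
loops, so reg^(D')_ε ∝ (1+o(1))·reg^D_ε on {dist(γ, A) ≥ η}, and portmanteau + boundary avoidance of
Q pass the identity to the limit. [deps: ChaosExists] [difficulty: L] -/
@[route_item "route-CriticalPhenomena-SAWLoopAvoidanceChaos", crux]
def ChaosRestriction : Prop :=
  ∀ sle2 : Literature.Probability.RandomPlanarGeometry.ChordalFamily, (∀ D : Literature.Probability.RandomPlanarGeometry.DobrushinDomain, Literature.Probability.RandomPlanarGeometry.IsSLELaw 2 D (sle2 D)) → ∀ (θ : ℝ → ℝ) (Q : Literature.Probability.RandomPlanarGeometry.ChordalFamily), Q.IsChordal → (∀ D : Literature.Probability.RandomPlanarGeometry.DobrushinDomain, ∀ᵐ γ ∂(Q D), γ ∈ Literature.Probability.RandomPlanarGeometry.CurveClass.simple ∧ γ.range ∩ frontier D.carrier ⊆ {D.pt 0, D.pt 1}) → (∀ D : Literature.Probability.RandomPlanarGeometry.DobrushinDomain, let box : ℝ → Literature.Probability.LatticeModels.Site 2 → Set ℂ := fun ε x => {z : ℂ | |z.re - ε * ((x 0 : ℤ) : ℝ)| ≤ ε / 2 ∧ |z.im - ε * ((x 1 : ℤ)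 : ℝ)| ≤ ε / 2}; let hit : ℝ → Literature.Probability.RandomPlanarGeometry.CurveClass ℂ → Set (Literature.Probability.LatticeModels.Site 2) := fun ε γ => {x | x ∈ Literature.Probability.LatticeModels.meshDomain D.carrier ε ∧ (box ε x ∩ γ.range).Nonempty}; let mass : ℝ → Set (Literature.Probability.LatticeModels.Site 2) → ℝ := fun ε W => ∑' p : (Σ x : Literature.Probability.LatticeModels.Site 2, (Literature.Probability.LatticeModels.discreteDomainGraph D.carrier ε).Walk x x), (if 0 < p.2.length ∧ (∃ v ∈ p.2.support, v ∈ W) then ((1 : ℝ) / 4) ^ p.2.length / (p.2.length : ℝ) else 0); let dens : ℝ → Literature.Probability.RandomPlanarGeometry.CurveClass ℂ → ℝ := fun ε γ => Real.exp (θ ε * ((hit ε γ).ncard : ℝ) - mass ε (hit ε γ)); let reg : ℝ → MeasureTheory.Measure (Literature.Probability.RandomPlanarGeometry.CurveClass ℂ) := fun ε => (∫⁻ γ, ENNReal.ofReal (dens ε γ) ∂(sle2 D))⁻¹ • (sle2 D).withDensity (fun γ => ENNReal.ofReal (dens ε γ)); Literature.Probability.RandomPlanarGeometry.TendstoLaw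 (fun (_ : ℝ) (x : Literature.Probability.RandomPlanarGeometry.CurveClass ℂ) => x) reg id (Q D)) → Q.IsRestriction

/-- item stmt-CriticalPhenomena-0775 · support · rank 9 · closed · proved by Summit.CriticalPhenomena.SAWScalingLimit.Theorems.LSWRestrictionFact_proof (prover) · by planner
sources: LawlerSchrammWerner2003Restriction, Lawler2008
[support] Literature fact wanted (Lawler–Schramm–Werner, Conformal restriction: the chordal case,
JAMS 16 (2003), arXiv:math/0209343: p.5 results 1–2, Prop. 3.3, Thm 6.1, Cor. 8.6): given
existence/uniqueness of the chordal SLE law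
(Literature.Probability.RandomPlanarGeometry.exists_isSLECurve,
Literature.Probability.RandomPlanarGeometry.IsSLECurve.map_eq), a chordal family on Dobrushin
domains that is conformally covariant, has the restriction property and is carried by simple curves
meeting the boundary only at the marked points is, in every domain, the chordal SLE_{8/3} law
(Literature.Probability.RandomPlanarGeometry.IsSLELaw (8/3)). Transposition Jordan-subdomains ↔
smooth hulls of ℍ via a chordal uniformizing map. Expected to close by citation. -/
@[route_item "route-CriticalPhenomena-SAWLoopAvoidanceChaos"]
def LSWRestrictionFact : Prop :=
  Literature.Probability.RandomPlanarGeometry.exists_isSLECurve → Literature.Probability.RandomPlanarGeometry.IsSLECurve.map_eq → ∀ P : Literature.Probability.RandomPlanarGeometry.ChordalFamily, P.IsChordal → (∀ (D D' : Literature.Probability.RandomPlanarGeometry.DobrushinDomain) (g : Literature.Probability.RandomPlanarGeometry.ConformalEquiv D.carrier D'.carrier) (Φ : C(ℂ, ℂ)), g.HasBoundaryValue (D.pt 0) (D'.pt 0) → g.HasBoundaryValue (D.pt 1) (D'.pt 1) → Set.EqOn Φ g D.carrier → P D' = (P D).map (Literature.Probability.RandomPlanarGeometry.CurveClass.map Φ))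 → (∀ (D D' : Literature.Probability.RandomPlanarGeometry.DobrushinDomain), D'.carrier ⊆ D.carrier → D'.pt 0 = D.pt 0 → D'.pt 1 = D.pt 1 → ∀ T : Set (Literature.Probability.RandomPlanarGeometry.CurveClass ℂ), MeasurableSet T → P D' T * P D (Literature.Probability.RandomPlanarGeometry.CurveClass.rangeSubset (closure D'.carrier)) = P D (T ∩ Literature.Probability.RandomPlanarGeometry.CurveClass.rangeSubset (closure D'.carrier))) → (∀ D : Literature.Probability.RandomPlanarGeometry.DobrushinDomain, ∀ᵐ γ ∂(P D), γ ∈ Literature.Probability.RandomPlanarGeometry.CurveClass.simple ∧ γ.range ∩ frontier D.carrier ⊆ {D.pt 0, D.pt 1}) → ∀ D : Literature.Probability.RandomPlanarGeometry.DobrushinDomain, Literature.Probability.RandomPlanarGeometry.IsSLELaw ((8 : NNReal) / 3) D (P D)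

/-- `LSWRestrictionFact` holds: proved by `Summit.CriticalPhenomena.SAWScalingLimit.Theorems.LSWRestrictionFact_proof`. -/
theorem LSWRestrictionFact_holds : LSWRestrictionFact := _root_.Summit.CriticalPhenomena.SAWScalingLimit.Theorems.LSWRestrictionFact_proof

/-- item stmt-CriticalPhenomena-10499 · support · rank 9 · open · by planner
[support] The chordal SLE₂ law exists in every Dobrushin domain (the reference law of the
loop-avoidance scheme; every crux quantifies over an SLE₂ family, so the deciding theorem `closes`
needs one). PROVABLE NOW by one line in a Theorems file importing
Literature.Probability.RandomPlanarGeometry.SLEExistenceNeEightHolds: `fun D =>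
exists_isSLELaw_of_ne_eight (κ := 2) (by norm_num) (by norm_num) D` (Rohde–Schramm 2005 Thm 5.1 +
Thm 7.1, κ = 2 ≠ 8; planner-checked rc 0). Kept out of the route imports on purpose (that module
pulls ~264 Literature modules; same convention as SAWLoopLift.SLELawExists,
stmt-CriticalPhenomena-10341). [difficulty: provable-now] Sources: RohdeSchramm2005 Thm 5.1, Thm
7.1; Lawler2005 §6.3. -/
@[route_item "route-CriticalPhenomena-SAWLoopAvoidanceChaos", crux]
def SLETwoLawExists : Prop :=
  ∀ D : Literature.Probability.RandomPlanarGeometry.DobrushinDomain, ∃ μ : MeasureTheory.Measure (Literature.Probability.RandomPlanarGeometry.CurveClass ℂ), Literature.Probability.RandomPlanarGeometry.IsSLELaw 2 D μ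

/-- item stmt-CriticalPhenomena-3017 · support · rank 9 · closed · proved by Summit.CriticalPhenomena.SAWScalingLimit.Theorems.LSWSimpleRestrictionIsSLE_proof @ db6b0749abc7 (prover) · by planner
[support] LSW03 classification in HYPOTHESIS-FREE form (route repair 2026-08-15; implies the shared
item stmt-CriticalPhenomena-0775 = LSWRestrictionFact verbatim, see planner Sketch.lean
`lsw_new_implies_old`): a chordal family on Dobrushin domains that is chordal, conformally covariant
(ChordalFamily.IsConformallyCovariant), has the two-sided restriction property
(ChordalFamily.IsRestriction) and is carried by simple curves meeting ∂D only at the two marked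
points is, in every domain, the chordal SLE_{8/3} law (IsSLELaw (8/3)). The named-fact hypotheses of
stmt-0775 are dropped because they are not needed at κ = 8/3: existence is the library THEOREM
Literature.Probability.RandomPlanarGeometry.exists_isSLECurve_eightThirds (SLEExistenceNeEightHolds;
Rohde–Schramm Thm 5.1 + Thm 7.1; axiom closure propext/choice/Quot.sound checked), uniqueness in law
is IsSLECurve.map_eq_holds (SLEUniquenessInLaw); `exists_isSLECurve` for ALL κ is equivalent to the
unproved SLE₈ trace theorem (hasSLETrace_eight, SLETransienceIffTrace) and must not burden an
SLE_{8/3} route. Sources: LawlerSchrammWerner2003Restriction (arXiv:math/0209343: p.5 results 1–2,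
Prop. 3.3, Thm 6.1, Cor. 8.6), RohdeSchramm20 -/
@[route_item "route-CriticalPhenomena-SAWLoopAvoidanceChaos", crux]
def LSWRestrictionFact83 : Prop :=
  ∀ P : Literature.Probability.RandomPlanarGeometry.ChordalFamily, P.IsChordal → P.IsConformallyCovariant → P.IsRestriction → (∀ D : Literature.Probability.RandomPlanarGeometry.DobrushinDomain, ∀ᵐ γ ∂(P D), γ ∈ Literature.Probability.RandomPlanarGeometry.CurveClass.simple ∧ γ.range ∩ frontier D.carrier ⊆ {D.pt 0, D.pt 1}) → ∀ D : Literature.Probability.RandomPlanarGeometry.DobrushinDomain, Literature.Probability.RandomPlanarGeometry.IsSLELaw ((8 : NNReal) / 3) D (P D)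

/-- `LSWRestrictionFact83` holds: proved by `Summit.CriticalPhenomena.SAWScalingLimit.Theorems.LSWSimpleRestrictionIsSLE_proof` @ db6b0749abc7. -/
theorem LSWRestrictionFact83_holds : LSWRestrictionFact83 := _root_.Summit.CriticalPhenomena.SAWScalingLimit.Theorems.LSWSimpleRestrictionIsSLE_proof

/-- item stmt-CriticalPhenomena-4525 · support · rank 9 · open · by planner
sources: KennedyLawler2013, KozdronLawler2007, LawlerSchrammWerner2004SAW
[support] Unconditional companion of LatticeIsChaos (numerics target and refutation guard): for SOME
counterterm θ, in every Dobrushin domain and endpoint approximation, for every bounded continuous f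
and η > 0 there is ε₀ > 0 with |∫ f∘curve dSAW.law_δ − ∫ f d reg_ε^D| < η for all ε ∈ (0, ε₀),
eventually in δ. It forces uniqueness of subsequential SAW limits (they all equal lim_ε reg_ε^D) and
is what the kit experiment tests at accessible ε; its negation retires the card. [difficulty:
open-problem] -/
@[route_item "route-CriticalPhenomena-SAWLoopAvoidanceChaos"]
def LatticeIsChaosSome : Prop :=
  ∀ sle2 : Literature.Probability.RandomPlanarGeometry.ChordalFamily, (∀ D : Literature.Probability.RandomPlanarGeometry.DobrushinDomain, Literature.Probability.RandomPlanarGeometry.IsSLELaw 2 D (sle2 D)) → ∃ θ : ℝ → ℝ, ∀ (D : Literature.Probability.RandomPlanarGeometry.DobrushinDomain) (a b : ℝ → Literature.Probability.LatticeModels.Site 2), Literature.Probability.RandomPlanarGeometry.SAW.IsEndpointApprox D a b → let box : ℝ → Literature.Probability.LatticeModels.Site 2 → Set ℂ := fun ε x => {z : ℂ | |z.re - ε * ((x 0 : ℤ) : ℝ)| ≤ ε / 2 ∧ |z.im - ε * ((x 1 : ℤ) : ℝ)| ≤ ε / 2}; let hit : ℝ → Literature.Probability.RandomPlanarGeometry.CurveClass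 ℂ → Set (Literature.Probability.LatticeModels.Site 2) := fun ε γ => {x | x ∈ Literature.Probability.LatticeModels.meshDomain D.carrier ε ∧ (box ε x ∩ γ.range).Nonempty}; let mass : ℝ → Set (Literature.Probability.LatticeModels.Site 2) → ℝ := fun ε W => ∑' p : (Σ x : Literature.Probability.LatticeModels.Site 2, (Literature.Probability.LatticeModels.discreteDomainGraph D.carrier ε).Walk x x), (if 0 < p.2.length ∧ (∃ v ∈ p.2.support, v ∈ W) then ((1 : ℝ) / 4) ^ p.2.length / (p.2.length : ℝ) else 0); let dens : ℝ → Literature.Probability.RandomPlanarGeometry.CurveClass ℂ → ℝ := fun ε γ => Real.exp (θ ε * ((hit ε γ).ncard : ℝ) - mass ε (hit ε γ)); let reg : ℝ → MeasureTheory.Measure (Literature.Probability.RandomPlanarGeometry.CurveClass ℂ) := fun ε => (∫⁻ γ, ENNReal.ofReal (dens ε γ) ∂(sle2 D))⁻¹ • (sle2 D).withDensity (fun γ => ENNReal.ofReal (dens ε γ)); ∀ (f : BoundedContinuousFunction (Literature.Probability.RandomPlanarGeometry.CurveClass ℂ) ℝ) (η : ℝ), 0 < η → ∃ ε₀ : ℝ,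 0 < ε₀ ∧ ∀ ε ∈ Set.Ioo (0 : ℝ) ε₀, ∀ᶠ δ in nhdsWithin (0 : ℝ) (Set.Ioi 0), |(∫ γ, f γ.curve ∂(Literature.Probability.RandomPlanarGeometry.SAW.law D.carrier δ (a δ) (b δ))) - ∫ x, f x ∂(reg ε)| < η

/-- item stmt-CriticalPhenomena-4526 · support · rank 9 · open · by planner
sources: LawlerLimic2010, Lawler2018, KozdronLawler2007, KennedyLawler2013, LawlerTrujilloferreras2006
[support] The exact lattice anchor, typed with Mathlib's `SimpleGraph.Walk.bypass` (=
reverse-chronological loop erasure; the identity is insensitive to the erasure order because F_η =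
exp m(loops meeting the SET η) and 4^(−|ω|) is reversal-symmetric): for bounded Ω, δ > 0 and every
SAW η of Ω_δ from a to b, Σ_(ω : walks a → b of Ω_δ with bypass ω = η) 4^(−|ω|) = 4^(−|η|) ·
exp(m^RW(loops of Ω_δ meeting η)) (Lawler–Limic Prop 9.5.1 with Lemma 9.3.2; Lawler2018 Prop 3.1;
reversal: Lawler 1991 Lemma 7.2.1). Dividing by G_(Ω_δ)(a,b) = Σ_ω 4^(−|ω|) this says LERW_δ(η) =
4^(−|η|) F_η / G, and with x_c^(|η|) = (4x_c)^(|η|)·4^(−|η|): SAW.weight{η} ∝ LERW_δ(η) · P[unit RW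
loop soup on Ω_δ misses η] · (4x_c)^(|η|) — the c = 0 ↔ c = −2 dictionary the whole route rests on.
Provable now in principle (finite combinatorics of loop insertion), sizeable as a formalisation.
[difficulty: L] -/
@[route_item "route-CriticalPhenomena-SAWLoopAvoidanceChaos"]
def LoopErasureIdentity : Prop :=
  ∀ (Ω : Set ℂ) (δ : ℝ) (a b : Literature.Probability.LatticeModels.Site 2) (η : Literature.Probability.RandomPlanarGeometry.SAW.DomainSAW Ω δ a b), Bornology.IsBounded Ω → 0 < δ → (∑' ω : (Literature.Probability.LatticeModels.discreteDomainGraph Ω δ).Walk a b, (if ω.bypass = η.walk then ((1 : ℝ) / 4) ^ ω.length else 0)) = ((1 : ℝ) / 4) ^ η.length * Real.exp (∑' p : (Σ x : Literature.Probability.LatticeModels.Site 2, (Literature.Probability.LatticeModels.discreteDomainGraph Ω δ).Walk x x), (if 0 < p.2.length ∧ (∃ v ∈ p.2.support, v ∈ η.walk.support) then ((1 : ℝ) / 4) ^ p.2.length / (p.2.length : ℝ) else 0))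

/-- item stmt-CriticalPhenomena-4527 · assembly · rank 1 · open · by planner
sources: LawlerSchrammWerner2003Restriction, LawlerSchrammWerner2004SAW
[assembly] exists_isSLECurve → IsSLECurve.map_eq → LSWRestrictionFact → ChaosExists → ChaosConformal
→ ChaosRestriction → LatticeIsChaos → SAWScalingLimit. -/
@[route_item "route-CriticalPhenomena-SAWLoopAvoidanceChaos"]
def Assembly : Prop :=
  Literature.Probability.RandomPlanarGeometry.exists_isSLECurve → Literature.Probability.RandomPlanarGeometry.IsSLECurve.map_eq → LSWRestrictionFact → ChaosExists → ChaosConformal → ChaosRestriction → LatticeIsChaos → SAWScalingLimit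

-- records of items no longer active in this route (dropped / restated):
-- earlier Assembly2 (stmt-CriticalPhenomena-7130, dropped 2026-08-16T14:43:06Z): moot by None — ChaosExists → ChaosConformal → ChaosRestriction → LatticeIsChaos → SAWScalingLimit

/-! D-0027 §2.1 — DECIDING THEOREM (planner-authored via `route open/edit --closes-file`; by planner-rbadge-CriticalPhenomena-SAWLoopAvoida-3cc72acd-g5-0 2026-08-15T16:53:48Z):
its hypotheses are this route's items and its conclusion the sub-problem Statement (glue_lint), and it elaborates with this file. -/

@[closes "route-CriticalPhenomena-SAWLoopAvoidanceChaos"] theorem closes (hE : ChaosExists) (hU : ChaosConformal) (hR : ChaosRestriction) (hL : LatticeIsChaos)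
    (hS : SLETwoLawExists) (hW : LSWRestrictionFact83) : _root_.SAWScalingLimit := by
  classical
  -- an SLE₂ family, domain by domain
  choose sle2 hsle2 using hS
  -- (E): counterterm θ and the limit chordal family Q of the regularised loop-avoidance laws
  obtain ⟨θ, Q, hQch, hQsimple, hconv⟩ := hE sle2 hsle2
  -- (U), (R): Q is conformally covariant and restriction
  have hcc : Q.IsConformallyCovariant := hU sle2 hsle2 θ Q hQch hQsimple hconv
  have hres : Q.IsRestriction := hR sle2 hsle2 θ Q hQch hQsimple hconv
  intro D a b hab
  -- LSW03 at κ = 8/3: Q D is the chordal SLE_{8/3} law, i.e. the law of an SLE_{8/3} curve Γ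
  obtain ⟨Γ, hΓ, hQD⟩ := hW Q hQch hcc hres hQsimple D
  refine ⟨Γ, hΓ, Filter.Eventually.of_forall fun δ =>
    Literature.Probability.RandomPlanarGeometry.SAW.aemeasurable_curve _ _ _ _, fun f => ?_⟩
  have key : ∫ ω, f (Γ ω) ∂Literature.Probability.Process.preWienerMeasure = ∫ γ, f γ ∂(Q D) := by
    rw [hQD]
    exact (MeasureTheory.integral_map hΓ.aemeasurable f.continuous.aestronglyMeasurable).symm
  rw [key]
  -- (L): the SAW law at mesh δ is η-close to reg_ε for ε < ε₀, eventually in δ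
  have hLD := hL sle2 hsle2 θ Q hQch hQsimple hcc hres D a b hab (hconv D)
  -- reg_ε → Q D as ε → 0+, then the two-scale (ε/δ) squeeze
  have twoScale : ∀ {A B : ℝ → ℝ} {t : ℝ}, Tendsto B (𝓝[>] (0 : ℝ)) (𝓝 t) →
      (∀ η : ℝ, 0 < η → ∃ ε₀ : ℝ, 0 < ε₀ ∧ ∀ ε ∈ Set.Ioo (0 : ℝ) ε₀,
        ∀ᶠ δ in 𝓝[>] (0 : ℝ), |A δ - B ε| < η) →
      Tendsto A (𝓝[>] (0 : ℝ)) (𝓝 t) := by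
    intro A B t hB hAB
    rw [Metric.tendsto_nhds] at hB ⊢
    intro η hη
    obtain ⟨ε₀, hε₀, hε⟩ := hAB (η / 2) (half_pos hη)
    obtain ⟨ε, hεc, hεI⟩ := ((hB (η / 2) (half_pos hη)).and (Ioo_mem_nhdsGT hε₀)).exists
    filter_upwards [hε ε hεI] with δ hδ
    rw [Real.dist_eq] at hεc ⊢
    obtain ⟨h1, h2⟩ := abs_sub_lt_iff.mp hδ
    obtain ⟨h3, h4⟩ := abs_sub_lt_iff.mp hεc
    rw [abs_sub_lt_iff]
    constructor <;> linarith
  exact twoScale ((hconv D) f) (hLD f)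

end Summit.CriticalPhenomena.SAWScalingLimit.Theses.SAWLoopAvoidanceChaos
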